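import Literature.NumberTheory.Automorphic.ArchWhittakerBiDistribution
import Literature.NumberTheory.Automorphic.ArchWhittakerGKSymmetry
import Literature.NumberTheory.Automorphic.GLnGelfandKazhdanInvolution
import HarnessLib

/-!
# Archimedean uniqueness of Whittaker functionals, and multiplicity one for `GL_n`, from the
# Gelfand–Kazhdan / Shalika symmetry of bi-`ψ_∞`-quasi-invariant DISTRIBUTIONS on `GL_n(K_∞)`

Topic `NumberTheory/Automorphic`; namespace `Literature.NumberTheory.Automorphic`. The tree proves
multiplicity one for `L²_cusp(GL_n(𝔸_K))` from the archimedean local multiplicity one theorem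
(`multiplicity_one_gl_of_archWhittakerUnique`), and the latter from a symmetry of the Whittaker kernels
`⟪ξ^ℓ_φ, ξ^{ℓ'}_ψ⟫` of an irreducible unitary `τ` under an involution `J` of the test functions
(`multiplicity_one_gl_of_gkSymmetry`, the kernel form). This file reduces that kernel-form hypothesis to
the **classical statement on distributions** — the archimedean twin of the tree's PROVED `p`-adic theorem
`biWhittaker_gkInvolution_stable` (`GLnBiWhittakerDistributions`), i.e. Gelfand–Kazhdan's Theorem A at the
archimedean places, Shalika (1974), §2:

  **(GK_∞)** every distribution `T` on `G_∞ = GL_n(K_∞)` (`IsArchDistribution`) with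
  `T(λ(u) f) = ψ_∞(u) T(f)` and `T(ρ(u) f) = ψ_∞(u)⁻¹ T(f)` for `u ∈ N_n(K_∞)` satisfies
  `T(f ∘ ι) = T(f)`, `ι(g) = w⁰ ᵗg w⁰` (`gkInvolution`).

* §1 `ι` on `GL_n(K_∞)`: `ψ_∞(ι u) = ψ_∞(u)` (`archWhittakerChar_gkInvolution`), `f ∘ ι` and
  `J f = \overline{f ∘ θ}` (`gkJ`, `θ = gkAutomorphism = ι ∘ inv`) are test functions,
  `archTestFunctions.compGKInvolution`; the Haar measure is `θ`-invariant (`map_gkAutomorphism_archHaar`);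
* §2 Schwartz's dictionary through `J`: `(J φ) ⋆ (J ψ)^* = J (φ ⋆ ψ^*)`, `J F = F^* ∘ ι`,
  `(φ ⋆ ψ^*)^* = ψ ⋆ φ^*`;
* §3 `gkSymmetry_of_archBiWhittaker_gkInvolution_stable` — **(GK_∞) ⇒ the kernel symmetry**
  `⟪ξ^ℓ_{Jφ}, ξ^{ℓ'}_{Jψ}⟫ = ⟪ξ^ℓ_ψ, ξ^{ℓ'}_φ⟫` for every unitary strongly continuous `τ`: by the
  dictionary `⟪ξ^ℓ_a, ξ^{ℓ'}_b⟫ = T_{ℓ,ℓ'}(a ⋆ b^*)` of `ArchWhittakerBiDistribution`,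
  `⟪ξ_{Jφ}, ξ'_{Jψ}⟫ = T(J(φ ⋆ ψ^*)) = T((φ ⋆ ψ^*)^* ∘ ι) = T((φ ⋆ ψ^*)^*) = T(ψ ⋆ φ^*) = ⟪ξ_ψ, ξ'_φ⟫`,
  the third equality being (GK_∞) for the bi-Whittaker distribution `T = T_{ℓ,ℓ'}`;
* §4 `rank_archContWhittakerFunctionals_le_one_of_archBiWhittaker_gkInvolution_stable` (Shalika (1974),
  Thm. 3.1 for irreducible unitary `τ` of `GL_n(K_∞)`, granted (GK_∞)) and
  **`multiplicity_one_gl_of_archBiWhittaker_gkInvolution_stable : (GK_∞) → multiplicity_one_gl n K μ`**.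

(GK_∞) is kept as the explicit hypothesis `hA`; it is NOT proved here and no named fact is introduced.
Its printed proof (Shalika (1974), §2, after Gelfand–Kazhdan; Bruhat's theory of quasi-invariant
distributions on the Bruhat cells of `GL_n(ℝ)`, `GL_n(ℂ)`) is the remaining analytic input of
multiplicity one for `GL_n` in this tree.

## References

* J. A. Shalika, *The multiplicity one theorem for `GL_n`*, Ann. of Math. 100 (1974), §2, Thm. 3.1,
  Thm. 5.5 [Shalika1974].
* I. M. Gelfand, D. A. Kazhdan, *Representations of the group GL(n, K) where K is a local field* (1975),
  Thm. A [GelfandKazhdan1975].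
* E. G. F. Thomas, *The theorem of Bochner–Schwartz–Godement for generalised Gelfand pairs* (1984),
  Thm. E, Example (a) [Thomas1984GelfandPairs].
* J. R. Getz, H. Hahn, *An Introduction to Automorphic Representations* (2024), Thm. 11.3.1, Thm. 11.3.4
  [GetzHahn2024].
-/

noncomputable section

open MeasureTheory Measure NumberField NumberField.mixedEmbedding IsDedekindDomain Set Filter
open scoped MatrixGroups Topology Classical ContDiff Matrix.Norms.Operator ComplexConjugate InnerProductSpace

namespace Literature.NumberTheory.Automorphic

open GaloisRepresentations (glTransposeInv coe_glTransposeInv_apply)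

variable {n : ℕ} {K : Type} [Field K] [NumberField K]

attribute [local instance] glInfBorel borelSpace_glInf locallyCompactSpace_glInf
  secondCountableTopology_glInf

-- Mathlib idiom (Mathlib/Algebra/Lie/OfAssociative.lean): the commutator Lie ring on matrices
attribute [local instance 100] LieRing.ofAssociativeRing

-- as in `ArchGardingWhittaker`: the scoped `L∞`-operator normed ring structure on matrices is only
-- reducibly defeq to the Pi uniformity
set_option backward.isDefEq.respectTransparency false

local notation "G∞" => GL (Fin n) (mixedSpace K)

/-! ### 1. The Gelfand–Kazhdan involution on `GL_n(K_∞)` and test functions -/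

section Involution

/-- `τ(g) = ι(g⁻¹)` for the tree's automorphism `τ(g) = w⁰ ᵗg⁻¹ w⁰` written as in
`CuspidalContragredientInvolution` and `ι = gkInvolution`. [folklore] -/
theorem theta_eq_gkInvolution_inv {R : Type*} [CommRing R] [TopologicalSpace R] (g : GL (Fin n) R) :
    weylLong n R * glTransposeInv (Fin n) R g * weylLong n R = gkInvolution g⁻¹ := by
  rw [gkInvolution, inv_inv]

/-- The super-diagonal sum is `ι`-invariant: `Σ_i ι(u)_{i,i+1} = Σ_i u_{i,i+1}` (the super-diagonal is
reversed; `ι(g)_{ij} = g_{rev j, rev i}`, `coe_gkInvolution_apply`). [folklore] -/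
theorem superdiagSum_gkInvolution {R : Type*} [CommRing R] [TopologicalSpace R]
    (u : ↥(upperUnitriangular (Fin n) R)) :
    superdiagSum ⟨gkInvolution (u : GL (Fin n) R), gkInvolution_mem_upperUnitriangular u.2⟩ = superdiagSum u := by
  rw [superdiagSum_def, superdiagSum_def]
  have hL : ∀ i : Fin n, (∑ j : Fin n, if (i : ℕ) + 1 = j then
      ((gkInvolution (u : GL (Fin n) R) : GL (Fin n) R) : Matrix (Fin n) (Fin n) R) i j else 0) =
      ∑ j : Fin n, if (i : ℕ) + 1 = j then ((u : GL (Fin n) R) : Matrix (Fin n) (Fin n) R) j.rev i.rev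
        else 0 := fun i => Finset.sum_congr rfl fun j _ => by rw [coe_gkInvolution_apply]
  simp only [hL]
  rw [Finset.sum_comm, ← Equiv.sum_comp Fin.revPerm]
  refine Finset.sum_congr rfl fun i _ => ?_
  rw [← Equiv.sum_comp Fin.revPerm]
  refine Finset.sum_congr rfl fun j _ => ?_
  simp only [Fin.revPerm_apply, Fin.rev_rev]
  have hiff : ((j.rev : Fin n) : ℕ) + 1 = (i.rev : Fin n) ↔ (i : ℕ) + 1 = j := by
    rw [Fin.val_rev, Fin.val_rev]; omega
  by_cases h : (i : ℕ) + 1 = j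
  · rw [if_pos h, if_pos (hiff.2 h)]
  · rw [if_neg h, if_neg (fun h' => h (hiff.1 h'))]

/-- **`ψ_∞(ι u) = ψ_∞(u)`** for `u ∈ N_n(K_∞)` (Bump (1997), §4.4, p. 455: "`ψ_N(ι u) = ψ_N(u)`"; the generic
character depends only on the super-diagonal sum, `archWhittakerChar_eq_cexp`). [cite: Bump1997, §4.4, p. 455] -/
theorem archWhittakerChar_gkInvolution (u : ↥(upperUnitriangular (Fin n) (mixedSpace K))) :
    archWhittakerChar n K ⟨gkInvolution (u : G∞), gkInvolution_mem_upperUnitriangular u.2⟩ = archWhittakerChar n K u := by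
  rw [archWhittakerChar_eq_cexp, archWhittakerChar_eq_cexp, superdiagSum_gkInvolution]

/-- **`f ∘ ι` is a test function when `f` is** (`ι(g) = τ(g⁻¹)`: `comp_theta` and `comp_inv`). [folklore] -/
theorem IsArchTestFunction.comp_gkInvolution {f : G∞ → ℂ} (hf : IsArchTestFunction n K f) :
    IsArchTestFunction n K fun g => f (gkInvolution g) := by
  have h := (hf.comp_theta).comp_inv
  refine (congrArg (IsArchTestFunction n K) ?_).mp h
  funext g
  simp only [theta_eq_gkInvolution_inv, inv_inv]

/-- `f^* = \overline{f((·)⁻¹)}` is a test function when `f` is. [folklore] -/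
theorem IsArchTestFunction.mulStar {f : G∞ → ℂ} (hf : IsArchTestFunction n K f) : IsArchTestFunction n K (mulStar f) :=
  hf.comp_inv.conjugate

/-- **The involution `J f = \overline{f ∘ θ}`**, `θ(g) = ι(g⁻¹) = w⁰ ᵗg⁻¹ w⁰` (`gkAutomorphism`): the
anti-linear involution of the test functions through which the Gelfand–Kazhdan symmetry of distributions
becomes the symmetry of positive-definite kernels (Thomas (1984), Example (a), with `θ` in place of the
inversion). [cite: Thomas1984GelfandPairs, Example (a)] -/
def gkJ (f : G∞ → ℂ) (g : G∞) : ℂ := conj (f (gkAutomorphism g))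

omit [NumberField K] in
/-- `J f (g) = conj (f (ι(g⁻¹)))`. [folklore] -/
theorem gkJ_apply (f : G∞ → ℂ) (g : G∞) : gkJ f g = conj (f (gkInvolution g⁻¹)) := by
  rw [gkJ, gkAutomorphism_apply]

/-- `J` preserves test functions. [folklore] -/
theorem IsArchTestFunction.gkJ {f : G∞ → ℂ} (hf : IsArchTestFunction n K f) : IsArchTestFunction n K (gkJ f) := by
  have h := (hf.comp_theta).conjugate
  refine (congrArg (IsArchTestFunction n K) ?_).mp h
  funext g
  rw [gkJ_apply, theta_eq_gkInvolution_inv]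

omit [NumberField K] in
/-- `J (J f) = f`. [folklore] -/
theorem gkJ_gkJ (f : G∞ → ℂ) : gkJ (gkJ f) = f := by
  funext g
  rw [gkJ_apply, gkJ_apply, Complex.conj_conj]
  simp only [gkInvolution_inv, inv_inv, gkInvolution_gkInvolution]

namespace archTestFunctions

/-- **The involution `f ↦ f ∘ ι`** of `C_c^∞(G_∞)`, `ι = gkInvolution` (the archimedean twin of the
tree's `p`-adic `SchwartzBruhat.compGKInvolution`). [cite: Bump1997, §4.4, p. 455] -/
def compGKInvolution : ↥(archTestFunctions n K) →ₗ[ℂ] ↥(archTestFunctions n K) where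
  toFun f := ⟨fun h => (f : G∞ → ℂ) (gkInvolution h), f.2.comp_gkInvolution⟩
  map_add' _ _ := rfl
  map_smul' _ _ := rfl

/-- `(f ∘ ι)(h) = f (ι h)`. [folklore] -/
@[simp] theorem compGKInvolution_apply (f : ↥(archTestFunctions n K)) (h : G∞) :
    (compGKInvolution f : G∞ → ℂ) h = (f : G∞ → ℂ) (gkInvolution h) := rfl

/-- `f ↦ f ∘ ι` is an involution. [folklore] -/
theorem compGKInvolution_compGKInvolution (f : ↥(archTestFunctions n K)) :
    compGKInvolution (compGKInvolution f) = f := by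
  refine Subtype.ext (funext fun h => ?_)
  simp only [compGKInvolution_apply, gkInvolution_gkInvolution]

end archTestFunctions

/-- **The Haar measure of `GL_n(K_∞)` is invariant under `θ = gkAutomorphism`** (an involutive
automorphism of the topological group; `map_eq_self_of_involutive`). [folklore] -/
theorem map_gkAutomorphism_archHaar :
    Measure.map (gkAutomorphism (n := n) (R := mixedSpace K)) (archHaar n K) = archHaar n K := by
  haveI : (archHaar n K).Regular := by unfold archHaar; infer_instance
  exact map_eq_self_of_involutive (archHaar n K) _ fun g => by
    simp only [gkAutomorphism_apply, gkInvolution_inv, inv_inv, gkInvolution_gkInvolution]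

/-- Change of variables `g ↦ θ g` in a Haar integral on `GL_n(K_∞)`. [folklore] -/
theorem integral_comp_gkAutomorphism (F : G∞ → ℂ) :
    ∫ g, F (gkAutomorphism g) ∂(archHaar n K) = ∫ g, F g ∂(archHaar n K) := by
  set e : G∞ ≃ᵐ G∞ := ((gkAutomorphism (n := n) (R := mixedSpace K) : G∞ ≃ₜ* G∞) : G∞ ≃ₜ G∞).toMeasurableEquiv
    with he
  have hec : (e : G∞ → G∞) = (gkAutomorphism (n := n) (R := mixedSpace K)) := rfl
  have h := MeasureTheory.integral_map_equiv (μ := archHaar n K) e F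
  rw [hec, map_gkAutomorphism_archHaar] at h
  exact h.symm

end Involution

/-! ### 2. Schwartz's dictionary through `J` -/

section Dictionary

/-- **`(J φ) ⋆ (J ψ)^* = J (φ ⋆ ψ^*)`**: `∫ \overline{φ(θ(z y))} ψ(θ y) dy = \overline{∫ φ(θ z · y) \overline{ψ(y)} dy}`
by the change of variables `y ↦ θ y` (`θ` multiplicative and Haar-preserving). [folklore] -/
theorem mulConv_mulStar_gkJ (φ ψ : G∞ → ℂ) :
    mulConv (archHaar n K) (gkJ φ) (mulStar (gkJ ψ)) = gkJ (mulConv (archHaar n K) φ (mulStar ψ)) := by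
  funext z
  rw [mulConv_mulStar_apply', gkJ, mulConv_mulStar_apply', ← integral_conj,
    ← integral_comp_gkAutomorphism fun y => conj (φ (gkAutomorphism z * y) * conj (ψ y))]
  refine integral_congr_ae (ae_of_all _ fun y => ?_)
  simp only [gkJ, map_mul, Complex.conj_conj, map_mul gkAutomorphism]

omit [NumberField K] in
/-- **`J F = F^* ∘ ι`**: `\overline{F(ι(g⁻¹))} = F^*(ι g)` since `ι(g⁻¹) = ι(g)⁻¹`. [folklore] -/
theorem gkJ_eq_mulStar_comp_gkInvolution (F : G∞ → ℂ) : gkJ F = fun g => mulStar F (gkInvolution g) := by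
  funext g
  rw [gkJ_apply, mulStar_apply, gkInvolution_inv]

/-- **`(φ ⋆ ψ^*)^* = ψ ⋆ φ^*`** (the involution is an anti-automorphism of the convolution algebra and
`(ψ^*)^* = ψ`; substitution `y ↦ z y`). [folklore] -/
theorem mulStar_mulConv_mulStar (φ ψ : G∞ → ℂ) :
    mulStar (mulConv (archHaar n K) φ (mulStar ψ)) = mulConv (archHaar n K) ψ (mulStar φ) := by
  funext z
  rw [mulStar_apply, mulConv_mulStar_apply', mulConv_mulStar_apply', ← integral_conj,
    ← integral_mul_left_eq_self _ z]
  refine integral_congr_ae (ae_of_all _ fun y => ?_)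
  simp only [map_mul, Complex.conj_conj, inv_mul_cancel_left, mul_comm]

end Dictionary

/-! ### 3. The kernel symmetry from the symmetry of distributions -/

section Symmetry

variable {hcpt : isCompact_glFiniteIntegralLevel n K}
  {E : Type*} [NormedAddCommGroup E] [InnerProductSpace ℂ E] [CompleteSpace E]
  {τ : ContRepresentation ℂ (AutomorphyDatum.gl n K hcpt).arch.carrier E}

/-- **The Gelfand–Kazhdan symmetry of the archimedean Whittaker kernels from (GK_∞).** If every
bi-`ψ_∞`-quasi-invariant distribution on `G_∞` is `ι`-stable (`hA`: Shalika (1974), §2; Gelfand–Kazhdan's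
Theorem A at the archimedean places), then for every unitary strongly continuous `τ`, all continuous
`ψ_∞`-Whittaker functionals `ℓ, ℓ'` on its Gårding space and all test functions `φ, ψ`:
`⟪ξ^ℓ_{Jφ}, ξ^{ℓ'}_{Jψ}⟫ = ⟪ξ^ℓ_ψ, ξ^{ℓ'}_φ⟫` with `J f = \overline{f ∘ θ}` (`gkJ`). Proof:
`⟪ξ_{Jφ}, ξ'_{Jψ}⟫ = T(Jφ ⋆ (Jψ)^*) = T(J(φ ⋆ ψ^*)) = T((φ ⋆ ψ^*)^* ∘ ι) = T((φ ⋆ ψ^*)^*) = T(ψ ⋆ φ^*) =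
⟪ξ_ψ, ξ'_φ⟫` for the bi-Whittaker distribution `T = T_{ℓ,ℓ'}` (`ArchWhittakerBiDistribution`), the fourth
equality being `hA`. [cite: Shalika1974, §2–3] -/
theorem gkSymmetry_of_archBiWhittaker_gkInvolution_stable
    (hA : ∀ T : ↥(archTestFunctions n K) →ₗ[ℂ] ℂ, IsArchDistribution n K T →
      (∀ (u : ↥(upperUnitriangular (Fin n) (mixedSpace K))) (f : ↥(archTestFunctions n K)),
        T (archTestFunctions.leftTranslate (u : G∞) f) = archWhittakerChar n K u * T f) →
      (∀ (u : ↥(upperUnitriangular (Fin n) (mixedSpace K))) (f : ↥(archTestFunctions n K)),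
        T (archTestFunctions.rightTranslate (u : G∞) f) = (archWhittakerChar n K u)⁻¹ * T f) →
      ∀ f : ↥(archTestFunctions n K), T (archTestFunctions.compGKInvolution f) = T f)
    (hτu : τ.IsUnitary) (hτ : τ.IsStronglyContinuous) {ℓ ℓ' : archGardingSpace hcpt τ →ₗ[ℂ] ℂ}
    (hℓ : IsArchContWhittakerFunctional hcpt τ hτ ℓ) (hℓ' : IsArchContWhittakerFunctional hcpt τ hτ ℓ')
    {φ ψ : G∞ → ℂ} (hφ : IsArchTestFunction n K φ) (hψ : IsArchTestFunction n K ψ) :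
    ⟪whittakerRieszVector hcpt τ hτ ℓ (gkJ φ), whittakerRieszVector hcpt τ hτ ℓ' (gkJ ψ)⟫_ℂ =
      ⟪whittakerRieszVector hcpt τ hτ ℓ ψ, whittakerRieszVector hcpt τ hτ ℓ' φ⟫_ℂ := by
  set T := biWhittakerDistribution hcpt τ hτ hℓ hℓ' hτu with hT
  have hTι := hA T (isArchDistribution_biWhittakerDistribution hℓ hℓ' hτu)
    (fun u f => biWhittakerDistribution_leftTranslate u f) (fun u f => biWhittakerDistribution_rightTranslate u f)
  -- both sides through the dictionary
  rw [← biWhittakerDistribution_mulConv_mulStar (hℓ := hℓ) (hℓ' := hℓ') (hτu := hτu) hφ.gkJ hψ.gkJ,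
    ← biWhittakerDistribution_mulConv_mulStar (hℓ := hℓ) (hℓ' := hℓ') (hτu := hτu) hψ hφ]
  -- `(Jφ) ⋆ (Jψ)^* = J(φ ⋆ ψ^*) = (φ ⋆ ψ^*)^* ∘ ι` and `(φ ⋆ ψ^*)^* = ψ ⋆ φ^*`
  have hF : IsArchTestFunction n K (mulStar (mulConv (archHaar n K) φ (mulStar ψ))) :=
    (hφ.mulConv_mulStar hψ.continuous hψ.hasCompactSupport).mulStar
  have h1 : (⟨mulConv (archHaar n K) (gkJ φ) (mulStar (gkJ ψ)),
      hφ.gkJ.mulConv_mulStar hψ.gkJ.continuous hψ.gkJ.hasCompactSupport⟩ : ↥(archTestFunctions n K)) =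
      archTestFunctions.compGKInvolution ⟨mulStar (mulConv (archHaar n K) φ (mulStar ψ)), hF⟩ := by
    refine Subtype.ext ?_
    change mulConv (archHaar n K) (gkJ φ) (mulStar (gkJ ψ)) = fun h => mulStar (mulConv (archHaar n K) φ (mulStar ψ)) (gkInvolution h)
    rw [mulConv_mulStar_gkJ, gkJ_eq_mulStar_comp_gkInvolution]
  have h2 : (⟨mulConv (archHaar n K) ψ (mulStar φ), hψ.mulConv_mulStar hφ.continuous hφ.hasCompactSupport⟩ :
      ↥(archTestFunctions n K)) = ⟨mulStar (mulConv (archHaar n K) φ (mulStar ψ)), hF⟩ :=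
    Subtype.ext (mulStar_mulConv_mulStar φ ψ).symm
  change T _ = T _
  rw [h1, h2, hTι]

/-- **Shalika's archimedean local multiplicity one from (GK_∞)**: for an irreducible unitary strongly
continuous `τ` of `GL_n(K_∞)`, `dim (continuous ψ_∞-Whittaker functionals on the Gårding space) ≤ 1`
(Shalika (1974), Thm. 3.1; Getz–Hahn (2024), Thm. 11.3.1 with `F = ℝ`, `G = Res_{K/ℚ} GL_n`), granted the
symmetry (GK_∞) of bi-`ψ_∞`-quasi-invariant distributions (`hA`). [cite: Shalika1974, Thm. 3.1] -/
theorem rank_archContWhittakerFunctionals_le_one_of_archBiWhittaker_gkInvolution_stable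
    (hA : ∀ T : ↥(archTestFunctions n K) →ₗ[ℂ] ℂ, IsArchDistribution n K T →
      (∀ (u : ↥(upperUnitriangular (Fin n) (mixedSpace K))) (f : ↥(archTestFunctions n K)),
        T (archTestFunctions.leftTranslate (u : G∞) f) = archWhittakerChar n K u * T f) →
      (∀ (u : ↥(upperUnitriangular (Fin n) (mixedSpace K))) (f : ↥(archTestFunctions n K)),
        T (archTestFunctions.rightTranslate (u : G∞) f) = (archWhittakerChar n K u)⁻¹ * T f) →
      ∀ f : ↥(archTestFunctions n K), T (archTestFunctions.compGKInvolution f) = T f)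
    (hτu : τ.IsUnitary) (hτi : τ.IsTopIrreducible) (hτ : τ.IsStronglyContinuous) :
    Module.rank ℂ (archContWhittakerFunctionals hcpt τ hτ) ≤ 1 :=
  rank_archContWhittakerFunctionals_le_one_of_gkSymmetry hτu hτi hτ gkJ (fun _ hφ => hφ.gkJ) (fun φ _ => gkJ_gkJ φ)
    fun _ _ hℓ hℓ' _ _ hφ hψ => gkSymmetry_of_archBiWhittaker_gkInvolution_stable hA hτu hτ hℓ hℓ' hφ hψ

end Symmetry

/-! ### 4. Multiplicity one for `GL_n` from (GK_∞) -/

section MultiplicityOne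

variable (n K) (μ : Measure (AdelicGroupData.gl n K).automorphicQuotient)
  [(AdelicGroupData.gl n K).IsAutomorphicMeasure μ]

/-- **Multiplicity one for `L²_cusp(GL_n(𝔸_K))` from the Gelfand–Kazhdan / Shalika symmetry of
bi-`ψ_∞`-quasi-invariant distributions on `GL_n(K_∞)`** (Shalika (1974), Thm. 5.5, via Thm. 3.1 and §2;
Piatetski-Shapiro (1979); Getz–Hahn (2024), Thm. 11.3.4). The hypothesis `hA` is (GK_∞): every distribution
`T` on `G_∞ = GL_n(K_∞)` (a linear functional on `C_c^∞(G_∞)` continuous on each `C_c^∞(κ)`,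
`IsArchDistribution`) with `T(λ(u) f) = ψ_∞(u) T f` and `T(ρ(u) f) = ψ_∞(u)⁻¹ T f` for all
`u ∈ N_n(K_∞)` is stable under `f ↦ f ∘ ι`, `ι(g) = w⁰ ᵗg w⁰` — verbatim the archimedean counterpart of the
tree's `p`-adic theorem `biWhittaker_gkInvolution_stable` (Gelfand–Kazhdan (1975), Thm. A; Shalika (1974),
§2, for `ℝ` and `ℂ`, here for the finite product `K_∞ = ∏_{v ∣ ∞} K_v`). Everything else in the printed proof
of multiplicity one for `GL_n` is proved in the tree (`multiplicity_one_gl_of_gkSymmetry` and its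
antecedents). [cite: Shalika1974, §2 and Thm. 5.5] -/
theorem multiplicity_one_gl_of_archBiWhittaker_gkInvolution_stable
    (hA : ∀ T : ↥(archTestFunctions n K) →ₗ[ℂ] ℂ, IsArchDistribution n K T →
      (∀ (u : ↥(upperUnitriangular (Fin n) (mixedSpace K))) (f : ↥(archTestFunctions n K)),
        T (archTestFunctions.leftTranslate (u : GL (Fin n) (mixedSpace K)) f) = archWhittakerChar n K u * T f) →
      (∀ (u : ↥(upperUnitriangular (Fin n) (mixedSpace K))) (f : ↥(archTestFunctions n K)),
        T (archTestFunctions.rightTranslate (u : GL (Fin n) (mixedSpace K)) f) = (archWhittakerChar n K u)⁻¹ * T f) →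
      ∀ f : ↥(archTestFunctions n K), T (archTestFunctions.compGKInvolution f) = T f) :
    multiplicity_one_gl n K μ :=
  multiplicity_one_gl_of_gkSymmetry n K μ fun _ _ _ _ _ hτu _ hτ =>
    ⟨gkJ, fun _ hφ => hφ.gkJ, fun φ _ => gkJ_gkJ φ, fun _ _ hℓ hℓ' _ _ hφ hψ =>
      gkSymmetry_of_archBiWhittaker_gkInvolution_stable hA hτu hτ hℓ hℓ' hφ hψ⟩

end MultiplicityOne

end Literature.NumberTheory.Automorphic
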